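import Summits.QuantumFields.YangMills.Theorems.UnitScaleTiltProp7B8Prop7DivTerm
import Summits.QuantumFields.YangMills.Theorems.UnitScaleTiltProp7PV3CDEAtSPrint
import HarnessLib

/-!
# Route `UnitScaleTilt`, crux K1 child «MinimiserStabilityRegPr» (stmt-QuantumFields-19200), registered stub `stub_prop7From14` (skeleton birth_v7
# cc37a178…; leaf V3) — v8 ROW (D) IS A THEOREM: the divergence clause of [Balaban1985RegularSpaces] Prop. 7 at the T³ carrier («`U₁` in (19) at
# `ε₂ ≤ ¼` over `U₀ ∈ 𝔘_k(a)`, `a ≤ ε₂` ⇒ `|(D*_{U₁U₀}∂(U₁U₀))(b)| < 178·ε₂·η³`»), hence the hypothesis `stub_PV3D` of `Prop7PV3CDEAtSPrint.prop7From14At_v8`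
# for the presentation of record `S_v8 = tPrintFam (sPrint L T)`, and V3 ⇐ `stub_PV3A ∧ stub_PV3C ∧ stub_PV3E`

Cell `ym3-torus`, width seat `ym-ust-19200-w2` (gen 0; OWNER RULING g24-№1 A2′).  YM₃ on T³ is a ladder rung (R3), not the Clay problem; nothing here is a
claim about the crux, d = 4 or the mass gap.

THE PRINT.  [Balaban1985Variational] p. 299: *«Proposition 7 [6] implies that U_k belongs to the space (18) with ε₀ = O(1)C₁B₃ε₁»*; [6] =
[Balaban1985RegularSpaces], (1.9) p. 77 *«|(D*_U∂U)(b)| < α₀η²(Lʲη)⁻³»*, (1.47) p. 84, Prop. 7 p. 98.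

THE PROOF (per term of (1.2), then summed).  For `U = U₁U₀`, `x′ = x − e_ν`, `w = U₀(x′,ν)`, `A = U₁(x′,ν)`, `Q, Q′` the `U₀`-plaquettes at `x, x′`, `P = ΦQ`,
`P′ = Φ′Q′` the `U`-plaquettes (`Prop7B8Prop7DivAlg.holT_plaqWord_emb15`), `C, C′` the covariant curls of the exponent:
`D*_{U}P − D*_{U₀}Q − i·D*_{U₀}C = w^*[A^*P′A − P′]w + {w^*(Φ′ − 1 − iC′)w − (Φ − 1 − iC)} + {w^*(Φ′−1)(Q′−1)w − (Φ−1)(Q−1)}` (`decompT`); the first and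
third terms are `≤ 2|P′−1||A−1| + …` = `O(ε₂²η³)`; in the middle one `Φ − 1 − iC = (Φ − Φ♭) + f(Z₁,…,Z₄)` with `Φ − Φ♭ = O(|Q−1||W−1|) = O(aε₂η³)` and
`w^*f(Z′)w − f(Z) = f(Ad(w^*)Z′) − f(Z)` bounded by the Lipschitz constant `11ε₂η` of `f` (`Prop7ExpLipschitz`) times the transports `Σ|Ad(w^*)Z′ⱼ − Zⱼ| ≤ 5ε₂η²`
(`Prop7B8Prop7DivAlg.norm_transport_*`).  Summing (1.2) over `ν ≠ μ` with `|D*_{U₀}∂U₀| < aη³` and the (19) member `|D*_{U₀}D_{U₀}X| < ε₂η³` gives the clause.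

WHAT IS PROVED (sorry-free, no definition; the per-term estimate `≤ 117ε₂²η³` is `Prop7B8Prop7DivTerm.norm_covDerivT_term_sub_le`).
§2 **`norm_covDivT_emb15_lt`**, **`divSmall_emb15_of_in19`** (`DivSmall F n K (178ε₂) (emb15 U₀ U₁)`), **`regPr_emb15_of_in19`** (both clauses of (2):
   `U₁U₀ ∈ 𝔘_k(178ε₂)`), `hdiv_holds` (the hypothesis `hdiv` of `Prop7PV3CDERowD`/`Prop7PV3CDEAtSPrint.prop7From14At_v8_div` DISCHARGED).
§3 **`rowD_sPrint`** — the v8 row (D) text (hypothesis `hD` of `Prop7PV3CDEAtSPrint.prop7From14At_v8`) IS A THEOREM (`O₂ = 178`, `c = ¼`);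
   **`prop7From14At_v8_of_ACE`** — leaf V3 ⇐ `stub_PV3A ∧ stub_PV3C ∧ stub_PV3E` at `S_v8`.

HONEST SCOPE.  Rows (A) ([Balaban1985RegularSpaces] Thm 2 for the based letters), (C) (Props 5–6: contraction (116)–(121) + the R2 → Euler–Lagrange step) and
(E) ((141)–(142)) remain HYPOTHESES.  Count-neutral helper toward stmt-QuantumFields-19200 (`--supports`), not a proof of the stub.

References: T. Bałaban, CMP 99 (1985) 75–102 [Balaban1985RegularSpaces] ((1.1)–(1.2) p.76, (1.9) p.77, (1.47) p.84, Prop. 7 p.98); CMP 102 (1985) 277–309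
[Balaban1985Variational] ((2) p.278, (19) p.281, p.299, Prop. 7 p.299); CMP 99 (1985) 389–434 [Balaban1985BackgroundPropagators] ((3.1)–(3.4) pp.390–391).
-/

noncomputable section

namespace Summit.QuantumFields.YangMills.Theorems.Prop7B8Prop7Div


open Literature.MathematicalPhysics.QuantumFieldTheory.Balaban1983to89
open Literature.MathematicalPhysics.QuantumFieldTheory.Balaban1983to89.T3ContinuumYM3Torus
open Literature.MathematicalPhysics.QuantumFieldTheory.Balaban1983to89.T3UnitLawDensityEML (ℰp)
open Literature.MathematicalPhysics.QuantumFieldTheory.Balaban1983to89.T3DescentFibreTower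
open Literature.MathematicalPhysics.QuantumFieldTheory.Balaban1983to89.T3ConstrainedMinimiser
open Literature.MathematicalPhysics.QuantumFieldTheory.Balaban1983to89.T3TiltDescent
open Literature.MathematicalPhysics.QuantumFieldTheory.Balaban1983to89.T3RegularMinimiser (regThreshold)
open Literature.MathematicalPhysics.QuantumFieldTheory.Balaban1983to89.T3PrintedRegularMinimiser
open Literature.MathematicalPhysics.QuantumFieldTheory.Balaban1983to89.T3PrintedMinimiserExistence (regPr_mono plaqSmall_of_le regThreshold_mono divSmall_mono)
open B10Eq27TorusAxialLog (toUField unitsField unitsField_mem_unitaryUnits val_unitsField holT holT_plaqWord holT_plaqWord_eq_plaqHol)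
open B10Eq68TorusRegularity (plaqFT covDerivT covDivT)
open B7Prop1Explicit (plaqWord)
open B11 (Prop2Printed)
open T3Thm1Carrier
open T3Thm1CarrierNative (IsCritR2 Prop7From14At)
open T3SectALandauChart
open Summit.QuantumFields.YangMills.Theorems.Prop7CovariantCoercivity (norm_conj_sub_self_le')
open Summit.QuantumFields.YangMills.Theorems.Prop7B8Prop7Plaq (eta_le_one plaqSmall_emb15_of_in19 norm_exp_I_smul_sub_one_le')
open Summit.QuantumFields.YangMills.Theorems.Prop7ExpLipschitz (norm_plaq4_sub_plaq4_le)
open Summit.QuantumFields.YangMills.Theorems.Prop7B8Prop7DivAlg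
open Summit.QuantumFields.YangMills.Theorems.Prop7TPrint
open Summit.QuantumFields.YangMills.Theorems.Prop7SPrint
open Summit.QuantumFields.YangMills.Theorems.Prop7PV3CDELogChart (pos_of_in19)
open NormedSpace

open scoped Matrix.Norms.L2Operator

open Summit.QuantumFields.YangMills.Theorems.Prop7B8Prop7DivTerm (norm_covDerivT_term_sub_le)

/-! ## §3 The divergence clause, row (D) as a theorem, and V3 from (A), (C), (E) -/

section Divergence

variable (F : T3Family) (n K : ℕ)

/-- A sum over a finite set of directions of terms each bounded by `B` is bounded by `d·B`. [folklore] -/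
private theorem norm_sum_le_card_mul {s : Finset (Fin (F.P K).d)} {f : Fin (F.P K).d → Matrix (Fin 2) (Fin 2) ℂ} {B : ℝ} (hB0 : 0 ≤ B)
    (h : ∀ ν ∈ s, ‖f ν‖ ≤ B) : ‖∑ ν ∈ s, f ν‖ ≤ 3 * B := by
  rcases s.eq_empty_or_nonempty with hs | hs
  · rw [hs, Finset.sum_empty, norm_zero]; positivity
  · calc ‖∑ ν ∈ s, f ν‖ ≤ ∑ ν ∈ s, ‖f ν‖ := norm_sum_le _ _
      _ ≤ s.card • B := Finset.sum_le_card_nsmul _ _ _ h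
      _ = (s.card : ℝ) * B := by rw [nsmul_eq_mul]
      _ ≤ 3 * B := by
          have hc : (s.card : ℝ) ≤ 3 := by
            have : s.card ≤ Fintype.card (Fin (F.P K).d) := Finset.card_le_univ _
            rw [Fintype.card_fin] at this
            have hd : (F.P K).d = 3 := rfl
            exact_mod_cast this.trans hd.le
          exact mul_le_mul_of_nonneg_right hc hB0

/-- **THE DIVERGENCE CLAUSE OF [Balaban1985RegularSpaces] PROP. 7 AT THE T³ CARRIER**: for `U₁ = e^{iX}` in (19) at `ε₂ ≤ ¼` over `U₀ ∈ 𝔘_k(a)` (both clauses of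
(2)), `a ≤ ε₂`, every bond: `‖(D^{1*}_{U₁U₀}∂(U₁U₀))_μ(x)‖ < 178·ε₂·η³` — (1.2) summed over `ν ≠ μ` from the per-term estimate, the background's own clause
`< aη³` and the (19) member `|D^{1*}_{U₀}D¹_{U₀}X| < ε₂η³`. [cite: Balaban1985RegularSpaces, (1.2) p.76, (1.9) p.77, Prop. 7 p.98; Balaban1985Variational, (2) p.278, (19) p.281] -/
theorem norm_covDivT_emb15_lt {ε₂ a : ℝ} (hε₂ : ε₂ ≤ 1 / 4) (ha : a ≤ ε₂)
    {U₀ U₁ : GaugeField (F.P K) 0 (Matrix.specialUnitaryGroup (Fin 2) ℂ)} {X : PBond (F.P K) 0 → Matrix (Fin 2) (Fin 2) ℂ}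
    (hU₀ : RegPr F n K a U₀) (h19 : In19 F n K ε₂ U₀ U₁ X) (μ : Fin (F.P K).d) (x : Site (F.P K) 0) :
    ‖covDivT 1 (bgUnits F K (emb15 U₀ U₁)) μ x‖ < 178 * ε₂ * eta F n K ^ 3 := by
  set η : ℝ := eta F n K with hηdef
  have hη : 0 < η := eta_pos F n K
  have hε₂0 : 0 < ε₂ := pos_of_in19 h19
  have ha0 : 0 < a := pos_of_regPr F hU₀
  have hterm : ∀ ν α β, ‖covDerivT 1 (bgUnits F K (emb15 U₀ U₁)) ν (plaqFT (bgUnits F K (emb15 U₀ U₁)) α β) x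
      - covDerivT 1 (bgUnits F K U₀) ν (plaqFT (bgUnits F K U₀) α β) x
      - Complex.I • covDerivT 1 (bgUnits F K U₀) ν (covCurlT 1 (bgUnits F K U₀) X α β) x‖ ≤ 117 * ε₂ ^ 2 * η ^ 3 :=
    fun ν α β => norm_covDerivT_term_sub_le F n K hε₂ ha0 ha hU₀.1 h19 ν α β x
  -- (1.2): the three divergences are the same signed sums
  have e : covDivT 1 (bgUnits F K (emb15 U₀ U₁)) μ x
      = (covDivT 1 (bgUnits F K U₀) μ x + Complex.I • covCodiffCurlT 1 (bgUnits F K U₀) X μ x)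
        + (∑ ν ∈ Finset.Iio μ, (covDerivT 1 (bgUnits F K (emb15 U₀ U₁)) ν (plaqFT (bgUnits F K (emb15 U₀ U₁)) ν μ) x
            - covDerivT 1 (bgUnits F K U₀) ν (plaqFT (bgUnits F K U₀) ν μ) x
            - Complex.I • covDerivT 1 (bgUnits F K U₀) ν (covCurlT 1 (bgUnits F K U₀) X ν μ) x)
          - ∑ ν ∈ Finset.Ioi μ, (covDerivT 1 (bgUnits F K (emb15 U₀ U₁)) ν (plaqFT (bgUnits F K (emb15 U₀ U₁)) μ ν) x
            - covDerivT 1 (bgUnits F K U₀) ν (plaqFT (bgUnits F K U₀) μ ν) x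
            - Complex.I • covDerivT 1 (bgUnits F K U₀) ν (covCurlT 1 (bgUnits F K U₀) X μ ν) x)) := by
    simp only [covDivT, covCodiffCurlT, covCodiffT, Finset.smul_sum, smul_sub, Finset.sum_sub_distrib]
    abel
  rw [e]
  have h0 : ‖covDivT 1 (bgUnits F K U₀) μ x‖ < a * η ^ 3 := by
    have := hU₀.2 ⟨x, μ⟩
    rw [hηdef, eta_pow]; exact this
  have h1 : ‖Complex.I • covCodiffCurlT 1 (bgUnits F K U₀) X μ x‖ < ε₂ * η ^ 3 := by
    rw [norm_smul, Complex.norm_I, one_mul]; exact h19.2.2.2.2.1 μ x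
  have hB0 : 0 ≤ 117 * ε₂ ^ 2 * η ^ 3 := by positivity
  have h2 := norm_sum_le_card_mul F K (s := Finset.Iio μ) hB0 (fun ν _ => hterm ν ν μ)
  have h3 := norm_sum_le_card_mul F K (s := Finset.Ioi μ) hB0 (fun ν _ => hterm ν μ ν)
  have hq : ε₂ ^ 2 * η ^ 3 ≤ ε₂ * η ^ 3 / 4 := by
    have : ε₂ ^ 2 ≤ ε₂ * (1 / 4) := by nlinarith
    nlinarith [pow_pos hη 3]
  calc _ ≤ ‖covDivT 1 (bgUnits F K U₀) μ x + Complex.I • covCodiffCurlT 1 (bgUnits F K U₀) X μ x‖ + ‖_‖ := norm_add_le _ _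
    _ ≤ (‖covDivT 1 (bgUnits F K U₀) μ x‖ + ‖Complex.I • covCodiffCurlT 1 (bgUnits F K U₀) X μ x‖)
          + (3 * (117 * ε₂ ^ 2 * η ^ 3) + 3 * (117 * ε₂ ^ 2 * η ^ 3)) :=
        add_le_add (norm_add_le _ _) ((norm_sub_le _ _).trans (add_le_add h2 h3))
    _ < (a * η ^ 3 + ε₂ * η ^ 3) + (3 * (117 * ε₂ ^ 2 * η ^ 3) + 3 * (117 * ε₂ ^ 2 * η ^ 3)) := by linarith
    _ ≤ 178 * ε₂ * η ^ 3 := by nlinarith [pow_pos hη 3]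

/-- **THE DIVERGENCE CLAUSE AS `DivSmall`**: `DivSmall F n K (178ε₂) (U₁U₀)`. [cite: Balaban1985RegularSpaces, (1.9) p.77, Prop. 7 p.98; Balaban1985Variational, (2) p.278] -/
theorem divSmall_emb15_of_in19 {ε₂ a : ℝ} (hε₂ : ε₂ ≤ 1 / 4) (ha : a ≤ ε₂)
    {U₀ U₁ : GaugeField (F.P K) 0 (Matrix.specialUnitaryGroup (Fin 2) ℂ)} {X : PBond (F.P K) 0 → Matrix (Fin 2) (Fin 2) ℂ}
    (hU₀ : RegPr F n K a U₀) (h19 : In19 F n K ε₂ U₀ U₁ X) : DivSmall F n K (178 * ε₂) (emb15 U₀ U₁) := by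
  intro b
  have h := norm_covDivT_emb15_lt F n K hε₂ ha hU₀ h19 b.dir b.src
  rw [eta_pow] at h
  exact h

/-- **`U₁U₀ ∈ 𝔘_k(178ε₂)` IN FULL** (both clauses of (2)) for `U₁` in (19) at `ε₂ ≤ ¼` over `U₀ ∈ 𝔘_k(a)`, `a ≤ ε₂` — [Balaban1985RegularSpaces] Prop. 7's estimate at the T³
carrier (plaquette clause `Prop7B8Prop7Plaq`, radius `2a + 11ε₂ ≤ 13ε₂ ≤ 178ε₂`). [cite: Balaban1985RegularSpaces, Prop. 7 p.98; Balaban1985Variational, (2) p.278, p.299] -/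
theorem regPr_emb15_of_in19 {ε₂ a : ℝ} (hε₂ : ε₂ ≤ 1 / 4) (ha : a ≤ ε₂)
    {U₀ U₁ : GaugeField (F.P K) 0 (Matrix.specialUnitaryGroup (Fin 2) ℂ)} {X : PBond (F.P K) 0 → Matrix (Fin 2) (Fin 2) ℂ}
    (hU₀ : RegPr F n K a U₀) (h19 : In19 F n K ε₂ U₀ U₁ X) : RegPr F n K (178 * ε₂) (emb15 U₀ U₁) := by
  have hε₂0 : 0 < ε₂ := pos_of_in19 h19
  have hpl := plaqSmall_emb15_of_in19 hε₂ hU₀.1 h19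
  have h13 : 2 * a + 11 * ε₂ ≤ 178 * ε₂ := by linarith
  exact ⟨plaqSmall_of_le (regThreshold_mono F h13) hpl, divSmall_emb15_of_in19 F n K hε₂ ha hU₀ h19⟩

variable {L : ℕ}

/-- **THE HYPOTHESIS `hdiv` OF `Prop7PV3CDERowD` ∕ `Prop7PV3CDEAtSPrint.prop7From14At_v8_div` DISCHARGED** (`O′ = 178`, `c′ = ¼`).
[cite: Balaban1985RegularSpaces, Prop. 7 p.98, (1.9) p.77] -/
theorem hdiv_holds :
    ∃ O' c' : ℝ, 0 < c' ∧ ∀ (i : Idx L) (ε₂ a : ℝ) (U₀ U₁ : GaugeField (i.1.1.P i.1.2.2) 0 (Matrix.specialUnitaryGroup (Fin 2) ℂ))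
      (X : PBond (i.1.1.P i.1.2.2) 0 → Matrix (Fin 2) (Fin 2) ℂ), a ≤ ε₂ → ε₂ ≤ c' → RegPr i.1.1 i.1.2.1 i.1.2.2 a U₀ → In19 i.1.1 i.1.2.1 i.1.2.2 ε₂ U₀ U₁ X →
        DivSmall i.1.1 i.1.2.1 i.1.2.2 (O' * ε₂) (emb15 U₀ U₁) :=
  ⟨178, 1 / 4, by norm_num, fun i _ _ _ _ _ ha hc hreg h19 => divSmall_emb15_of_in19 i.1.1 i.1.2.1 i.1.2.2 hc ha hreg h19⟩

/-- **v8 ROW (D) IS A THEOREM** — the text of `stub_PV3D` (hypothesis `hD` of `Prop7PV3CDEAtSPrint.prop7From14At_v8`, T-free over seat w1's letters): the p. 299 return to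
(18) in print's regime, «Proposition 7 [6] implies that U_k belongs to the space (18) with ε₀ = O(1)C₁B₃ε₁. It is a critical configuration of the functional (5)», for the
presentation of record (`Prop7PV3CDERowD.rowD_of_chartCritL_of_divEstimate` with `critLPrint_chart` and `hdiv_holds`). [cite: Balaban1985Variational, p.299 (before (141)); Balaban1985RegularSpaces, Prop. 7 p.98] -/
theorem rowD_sPrint (T : ResidFam L) (B₃ : ℝ) :
    ∃ O₂ c : ℝ, 1 ≤ O₂ ∧ 0 < c ∧ ∀ (i : Idx L) (ε₁ ε₂ : ℝ) (V : GaugeField (i.1.1.P i.1.2.1) 0 (Matrix.specialUnitaryGroup (Fin 2) ℂ))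
      (U₀ U₁ : GaugeField (i.1.1.P i.1.2.2) 0 (Matrix.specialUnitaryGroup (Fin 2) ℂ)) (X : PBond (i.1.1.P i.1.2.2) 0 → Matrix (Fin 2) (Fin 2) ℂ),
      (L : ℝ) ^ 3 * B₃ * ε₁ ≤ ε₂ → ε₂ ≤ c → RegPr i.1.1 i.1.2.1 i.1.2.2 ((L : ℝ) ^ 3 * B₃ * ε₁) U₀ → CloseAvg i.1.1 i.1.2.1 i.1.2.2 i.2.2.le ((L : ℝ) ^ 3 * ε₁) V U₀ →
      In19 i.1.1 i.1.2.1 i.1.2.2 ε₂ U₀ U₁ X → AvgCondPrint i.1.1 i.1.2.1 i.1.2.2 i.2.2.le V U₀ X → IsLandauPrint i.1.1 i.1.2.1 i.1.2.2 U₀ X →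
      CritLPrint i.1.1 i.1.2.1 i.1.2.2 i.2.2.le V U₀ U₁ →
        ∃ u : GaugeTransf (i.1.1.P i.1.2.2) 0 (Matrix.specialUnitaryGroup (Fin 2) ℂ), RestrictedPrint i.1.1 i.1.2.1 i.1.2.2 U₀ u ∧
          RegPr i.1.1 i.1.2.1 i.1.2.2 (O₂ * ε₂) (GaugeField.gaugeAct u (emb15 U₀ U₁)) ∧
          GaugeField.gaugeAct u (emb15 U₀ U₁) ∈ fibre i.1.1 ℰp i.1.2.1 i.1.2.2 i.2.2.le V ∧
          IsCritR2 i.1.1 i.1.2.1 i.1.2.2 i.2.2.le V (GaugeField.gaugeAct u (emb15 U₀ U₁)) :=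
  Prop7PV3CDERowD.rowD_of_chartCritL_of_divEstimate (sPrint L T) (Prop7PV3CDEAtSPrint.critLPrint_chart T) hdiv_holds

/-- **LEAF V3 AT `S_v8` FROM `stub_PV3A ∧ stub_PV3C ∧ stub_PV3E` ONLY** — `Prop7PV3CDEAtSPrint.prop7From14At_v8_div` with `hdiv_holds`: row (D) has left the stub set.
[cite: Balaban1985Variational, Prop. 7 p.299, Prop. 2 p.281, Props 5-6 pp.294-295, (141)-(142) p.299; Balaban1985RegularSpaces, Thm 2 p.83, Prop. 7 p.98] -/
theorem prop7From14At_v8_of_ACE (hL : 1 < L) (T : ResidFam L) {B₃ : ℝ} (hB₃ : 1 ≤ B₃)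
    (hA : ∃ B₁ c₁ : ℝ, 0 < B₁ ∧ 0 < c₁ ∧ Prop2Printed B₁ B₃ ((L : ℝ) ^ 3) c₁ (famLG3 L (sPrint L T)))
    (hC : ∃ B₀ a₄ : ℝ, 0 < B₀ ∧ 0 < a₄ ∧ ∀ (i : Idx L) (ε₁ ε₄ : ℝ), 0 < ε₁ → ε₄ ≤ a₄ → 2 * B₀ * (L : ℝ) ^ 3 * B₃ * ε₁ ≤ ε₄ →
        ∀ (V : GaugeField (i.1.1.P i.1.2.1) 0 (Matrix.specialUnitaryGroup (Fin 2) ℂ))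
          (U₀ : GaugeField (i.1.1.P i.1.2.2) 0 (Matrix.specialUnitaryGroup (Fin 2) ℂ)),
          RegPr i.1.1 i.1.2.1 i.1.2.2 ((L : ℝ) ^ 3 * B₃ * ε₁) U₀ → CloseAvg i.1.1 i.1.2.1 i.1.2.2 i.2.2.le ((L : ℝ) ^ 3 * ε₁) V U₀ →
          ∃ X : PBond (i.1.1.P i.1.2.2) 0 → Matrix (Fin 2) (Fin 2) ℂ,
            nMax19 i.1.1 i.1.2.1 i.1.2.2 U₀ X < ε₄ ∧
            ((∀ b : PBond (i.1.1.P i.1.2.2) 0, (X b).IsHermitian ∧ Matrix.trace (X b) = 0) ∧ AvgCondPrint i.1.1 i.1.2.1 i.1.2.2 i.2.2.le V U₀ X ∧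
              IsLandauPrint i.1.1 i.1.2.1 i.1.2.2 U₀ X ∧ CritLPrint i.1.1 i.1.2.1 i.1.2.2 i.2.2.le V U₀ (expHermField X)) ∧
            nMax19 i.1.1 i.1.2.1 i.1.2.2 U₀ X < 3 * B₀ * (L : ℝ) ^ 3 * B₃ * ε₁ ∧
            ∀ X' : PBond (i.1.1.P i.1.2.2) 0 → Matrix (Fin 2) (Fin 2) ℂ, nMax19 i.1.1 i.1.2.1 i.1.2.2 U₀ X' < ε₄ →
              ((∀ b : PBond (i.1.1.P i.1.2.2) 0, (X' b).IsHermitian ∧ Matrix.trace (X' b) = 0) ∧ AvgCondPrint i.1.1 i.1.2.1 i.1.2.2 i.2.2.le V U₀ X' ∧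
                IsLandauPrint i.1.1 i.1.2.1 i.1.2.2 U₀ X' ∧ CritLPrint i.1.1 i.1.2.1 i.1.2.2 i.2.2.le V U₀ (expHermField X')) → X' = X)
    (hE : ∃ e₅ : ℝ, 0 < e₅ ∧ ∀ (i : Idx L) (e ε₁ : ℝ) (V : GaugeField (i.1.1.P i.1.2.1) 0 (Matrix.specialUnitaryGroup (Fin 2) ℂ))
      (U₀ U₁ : GaugeField (i.1.1.P i.1.2.2) 0 (Matrix.specialUnitaryGroup (Fin 2) ℂ)) (u : GaugeTransf (i.1.1.P i.1.2.2) 0 (Matrix.specialUnitaryGroup (Fin 2) ℂ)),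
      e ≤ e₅ → RegPr i.1.1 i.1.2.1 i.1.2.2 ((L : ℝ) ^ 3 * B₃ * ε₁) U₀ → CloseAvg i.1.1 i.1.2.1 i.1.2.2 i.2.2.le ((L : ℝ) ^ 3 * ε₁) V U₀ →
      CritLPrint i.1.1 i.1.2.1 i.1.2.2 i.2.2.le V U₀ U₁ → RestrictedPrint i.1.1 i.1.2.1 i.1.2.2 U₀ u →
      RegPr i.1.1 i.1.2.1 i.1.2.2 e (GaugeField.gaugeAct u (emb15 U₀ U₁)) →
      GaugeField.gaugeAct u (emb15 U₀ U₁) ∈ fibre i.1.1 ℰp i.1.2.1 i.1.2.2 i.2.2.le V →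
      IsCritR2 i.1.1 i.1.2.1 i.1.2.2 i.2.2.le V (GaugeField.gaugeAct u (emb15 U₀ U₁)) →
        GaugeField.gaugeAct u (emb15 U₀ U₁) ∈ regFibrePr i.1.1 i.1.2.1 i.1.2.2 i.2.2.le e V ∧
        IsMinOn (fun W : GaugeField (i.1.1.P i.1.2.2) 0 (Matrix.specialUnitaryGroup (Fin 2) ℂ) => wilsonAction4 W)
          (regFibrePr i.1.1 i.1.2.1 i.1.2.2 i.2.2.le e V) (GaugeField.gaugeAct u (emb15 U₀ U₁))) :
    Prop7From14At L B₃ :=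
  Prop7PV3CDEAtSPrint.prop7From14At_v8_div hL T hB₃ hA hC hdiv_holds hE

end Divergence

end Summit.QuantumFields.YangMills.Theorems.Prop7B8Prop7Div

end
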